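import Literature.Analysis.FluidPDE.LerayHopfTimeSlice
import Literature.Analysis.FunctionSpaces.TimeMollification
import HarnessLib

/-!
# The time-sliced weak formulation of Leray–Hopf solutions — forced system

Analysis/FluidPDE support file: the **forced twin** of `Literature/Analysis/FluidPDE/LerayHopfTimeSlice.lean`
(whose `IsWeakNSSolutionOn.test_smul` / `IsLerayHopfOn.inner_test_eq` hard-code `f = 0`). It serves
the discharge of the forced Serrin–Masuda weak–strong uniqueness theorem (Sohr 2001, Thm. V.1.5.1;
tree fact `Literature.Analysis.FluidPDE.sohr2001_serrinMasuda_uniqueness_forced_memLp`), whose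
proof (Serrin 1963, §4; Sohr 2001, proof of Thm. V.1.4.1) starts, exactly as in the unforced case,
from the time-sliced form of the weak formulation: for a fixed smooth compactly supported
divergence-free field `Ψ` on `E` and every time `t`,

  `⟨u(t), Ψ⟩ = ⟨u₀, Ψ⟩ + ∫₀ᵗ ( ∫ (⟪u, (u·∇)Ψ⟫ + ν ⟪u, ΔΨ⟫) + ∫ ⟪f, Ψ⟫ ) ds`

(Serrin 1963, §3, (6) with the force term; Galdi 2000, Lemma 2.1 / Def. 2.1 with `f`; Sohr 2001,
Ch. V (1.1.3)–(1.1.4)). The force enters linearly and only through the slice pairings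
`s ↦ ∫ ⟪f(s), Ψ⟫`; these are genuine (Bochner) integrals and integrable in time as soon as `f` is
jointly a.e.-strongly measurable on `(0,T) × E` and square integrable there — the standing force
class of this discharge programme (`f ∈ L²((0,T) × E)`, a subclass of Sohr's
`f ∈ L¹_loc([0,T); L²)` on bounded intervals).

* `IsWeakNSSolutionOn.test_smul_forced`: testing the space–time formulation with
  `ψ(s,x) = η(s) Ψ(x)` gives `∫_{(0,T)} (η' U + η (F + P)) + η(0) ⟨u₀,Ψ⟩ = 0` with
  `U(s) = ⟨u(s),Ψ⟩`, `F(s) = ∫ (⟪u, (u·∇)Ψ⟫ + ν⟪u, ΔΨ⟫)`, `P(s) = ∫ ⟪f(s), Ψ⟫`;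
* `ae_memLp_two_slice_of_eLpNorm_prod`, `aestronglyMeasurable_forcePairing`,
  `integrableOn_forcePairing_of_eLpNorm_prod`: the slice/measurability/integrability bookkeeping
  of an `L²((0,T) × E)` force against an `L²` field;
* `IsLerayHopfOn.inner_test_eq_forced`: for a Leray–Hopf solution of the FORCED system,
  `U(t) = ⟨u₀,Ψ⟩ + ∫_{(0,t]} (F + P)` for **every** `t ∈ (0, T]`, by the du Bois-Reymond lemma with
  initial datum (`Literature.Analysis.FunctionSpaces.eq_add_setIntegral_of_forall_test`) and the
  weak `L²`-continuity clause of `IsLerayHopfOn` (continuous representative, endpoint `t = T`).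

The proofs are those of the unforced file with the force pairing threaded through; all
force-independent lemmas (`isSpaceTimeTestOn_smul`, `integrableOn_inner`, `integrableOn_flux`, …)
are imported from it.

## Mathlib / tree search

`lean search 'inner_test_eq|test_smul'`: only the `f = 0` versions (`LerayHopfTimeSlice`,
`WeakSolutionWeakContinuity.test_smul_ae`); the forced classical-solution files
(`LerayHopfForcedOpenStrip`, `TaoForcedFiniteEnergyLerayHopf*`) go from classical to Leray–Hopf and
do not slice the weak formulation of a GENERAL Leray–Hopf solution.

## References

* J. Serrin, *The initial value problem for the Navier–Stokes equations*, in: Nonlinear Problems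
  (Madison 1962), Univ. Wisconsin Press 1963, §3 (6), §4.
* G. P. Galdi, *An introduction to the Navier–Stokes initial-boundary value problem*, in:
  Fundamental Directions in Mathematical Fluid Mechanics, Birkhäuser 2000, §2, Lemma 2.1.
* H. Sohr, *The Navier–Stokes Equations. An Elementary Functional Analytic Approach*,
  Birkhäuser 2001, Ch. V, (1.1.3)–(1.1.4), Thm. 1.4.1, Thm. 1.5.1.
-/

noncomputable section

open MeasureTheory TopologicalSpace Set Function Filter Topology InnerProductSpace
open scoped RealInnerProductSpace ENNReal NNReal Laplacian ContDiff

namespace Literature.Analysis.FluidPDE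

variable {E : Type*} [NormedAddCommGroup E] [InnerProductSpace ℝ E] [FiniteDimensional ℝ E]
  [MeasurableSpace E] [BorelSpace E]

/-! ### The space–time weak formulation tested with a product field, with force -/

section Slice

variable {T ν : ℝ} {f : ℝ → E → E} {u₀ : E → E} {u : ℝ → E → E}

/-- **The space–time weak formulation of the FORCED system tested with a product field.** Let `u`
be a weak solution of the forced Navier–Stokes system on `E × [0, T)` (accepted
`IsWeakNSSolutionOn` with force `f`) whose slices `u(s)`, `s ∈ (0,T)`, are square integrable, let
the force slices `f(s)` be square integrable for a.e. `s ∈ (0,T)`, let `Ψ ∈ C_c^∞(E; E)` be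
divergence free and `η ∈ C_c^∞(ℝ)` with `supp η ⊆ (-∞, T)`. Testing with `ψ(s,x) = η(s)Ψ(x)` gives
`∫_{(0,T)} (η'(s) ⟨u(s),Ψ⟩ + η(s) (∫(⟪u,(u·∇)Ψ⟫ + ν⟪u,ΔΨ⟫) + ∫⟪f(s),Ψ⟫)) ds + η(0)⟨u₀,Ψ⟩ = 0`
(Serrin 1963, §3 with the force; Galdi 2000, proof of Lemma 2.1; Sohr 2001, Ch. V (1.1.4):
`∂ₜψ = η'Ψ`, `(u·∇)ψ = η (u·∇)Ψ`, `Δψ = η ΔΨ`, `⟪f, ψ⟫ = η ⟪f, Ψ⟫`, and the `x`-integral is linear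
because each pairing is integrable, for a.e. `s`). [cite: Serrin1963, §3 (6) with force; Galdi2000, Lemma 2.1] -/
theorem IsWeakNSSolutionOn.test_smul_forced (hu : IsWeakNSSolutionOn T ν f u₀ u)
    (hL2 : ∀ s ∈ Ioo 0 T, MemLp (u s) 2 volume)
    (hf2 : ∀ᵐ s ∂(volume.restrict (Ioo 0 T)), MemLp (f s) 2 volume)
    {Ψ : E → E} (hΨ : FunctionSpaces.IsTestFunctionOn (⊤ : Opens E) Ψ)
    (hΨdiv : VectorCalculus.IsDivFree Ψ)
    {η : ℝ → ℝ} (hη : ContDiff ℝ ∞ η) (hηc : HasCompactSupport η) (hηT : tsupport η ⊆ Iio T) :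
    (∫ s in Ioo 0 T, ((deriv η s * ∫ x, ⟪u s x, Ψ x⟫) +
        η s * ((∫ x, (⟪u s x, convect (u s) Ψ x⟫ + ν * ⟪u s x, (Δ Ψ) x⟫)) +
          ∫ x, ⟪f s x, Ψ x⟫))) +
      η 0 * ∫ x, ⟪u₀ x, Ψ x⟫ = 0 := by
  obtain ⟨-, -, -, hweak⟩ := hu
  have hΨd : Differentiable ℝ Ψ := hΨ.contDiff.differentiable (by simp)
  have hΨ2 : ContDiff ℝ 2 Ψ := contDiff_infty.1 hΨ.contDiff 2
  have hηd : Differentiable ℝ η := hη.differentiable (by simp)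
  have key := hweak (fun s x => η s • Ψ x) (isSpaceTimeTestOn_smul hη hηc hηT hΨ)
    (fun s => isDivFree_const_smul hΨdiv hΨd (η s))
  have hinit : ∫ x, ⟪u₀ x, η 0 • Ψ x⟫ = η 0 * ∫ x, ⟪u₀ x, Ψ x⟫ := by
    simp only [real_inner_smul_right]
    exact MeasureTheory.integral_const_mul _ _
  have hslice : ∀ᵐ s ∂(volume.restrict (Ioo 0 T)),
      ∫ x, (⟪u s x, timeDeriv (fun s x => η s • Ψ x) s x⟫ +
        ⟪u s x, convect (u s) (fun x => η s • Ψ x) x⟫ +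
        ν * ⟪u s x, (Δ fun x => η s • Ψ x) x⟫ + ⟪f s x, η s • Ψ x⟫) =
      (deriv η s * ∫ x, ⟪u s x, Ψ x⟫) +
        η s * ((∫ x, (⟪u s x, convect (u s) Ψ x⟫ + ν * ⟪u s x, (Δ Ψ) x⟫)) +
          ∫ x, ⟪f s x, Ψ x⟫) := by
    filter_upwards [hf2, ae_restrict_mem measurableSet_Ioo] with s hfs hs
    have i1 : Integrable (fun x => ⟪u s x, Ψ x⟫) volume :=
      integrable_inner_of_memLp_two (hL2 s hs) (hΨ.memLp_volume 2)
    have i2 : Integrable (fun x => ⟪u s x, convect (u s) Ψ x⟫ + ν * ⟪u s x, (Δ Ψ) x⟫) volume :=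
      (integrable_inner_fderiv_apply_of_memLp_two (hL2 s hs) (hL2 s hs) hΨ).add
        ((integrable_inner_of_memLp_two (hL2 s hs) (hΨ.memLp_laplacian 2)).const_mul ν)
    have i3 : Integrable (fun x => ⟪f s x, Ψ x⟫) volume :=
      integrable_inner_of_memLp_two hfs (hΨ.memLp_volume 2)
    have hpt : (fun x => ⟪u s x, timeDeriv (fun s x => η s • Ψ x) s x⟫ +
        ⟪u s x, convect (u s) (fun x => η s • Ψ x) x⟫ +
        ν * ⟪u s x, (Δ fun x => η s • Ψ x) x⟫ + ⟪f s x, η s • Ψ x⟫) =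
        fun x => deriv η s * ⟪u s x, Ψ x⟫ +
          (η s * (⟪u s x, convect (u s) Ψ x⟫ + ν * ⟪u s x, (Δ Ψ) x⟫) +
            η s * ⟪f s x, Ψ x⟫) := by
      ext x
      rw [timeDeriv_smul hηd, convect_const_smul (u s) hΨd, laplacian_const_smul hΨ2]
      simp only [real_inner_smul_right]
      ring
    have i23 : Integrable (fun x => η s * (⟪u s x, convect (u s) Ψ x⟫ + ν * ⟪u s x, (Δ Ψ) x⟫) +
        η s * ⟪f s x, Ψ x⟫) volume := (i2.const_mul _).add (i3.const_mul _)
    rw [hpt, integral_add (i1.const_mul _) i23, integral_add (i2.const_mul _) (i3.const_mul _),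
      MeasureTheory.integral_const_mul, MeasureTheory.integral_const_mul,
      MeasureTheory.integral_const_mul, mul_add]
  rw [setIntegral_congr_ae measurableSet_Ioo ((ae_restrict_iff' measurableSet_Ioo).1 hslice),
    hinit] at key
  exact key

/-! ### Bookkeeping of an `L²((0,T) × E)` force -/

/-- The iterated lower integral `∫₀ᵀ ∫ ‖g‖² < ∞` of a jointly a.e.-strongly measurable field with
`‖g‖_{L²((0,T) × E)} < ∞` (Tonelli; the standing integrability of the force class
`f ∈ L^s(0,T;L^q)` in Sohr 2001, Ch. V §1.4). [cite: Sohr2001, Ch. V §1.4, proof of Thm. 1.4.1 (bookkeeping step)] -/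
theorem lintegral_lintegral_sq_lt_top_of_eLpNorm_prod {g : ℝ → E → E}
    (hgm : AEStronglyMeasurable (uncurry g) ((volume.restrict (Ioo 0 T)).prod (volume : Measure E)))
    (hg2 : eLpNorm (uncurry g) 2 ((volume.restrict (Ioo 0 T)).prod (volume : Measure E)) < ⊤) :
    ∫⁻ s in Ioo 0 T, ∫⁻ x, ‖g s x‖ₑ ^ (2 : ℝ) < ⊤ := by
  have hprod : ∫⁻ z, ‖uncurry g z‖ₑ ^ (2 : ℝ) ∂((volume.restrict (Ioo 0 T)).prod (volume : Measure E))
      < ⊤ := by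
    have h := ENNReal.rpow_lt_top_of_nonneg zero_le_two hg2.ne
    rwa [eLpNorm_eq_eLpNorm' two_ne_zero ENNReal.ofNat_ne_top, ENNReal.toReal_ofNat,
      ← lintegral_rpow_enorm_eq_rpow_eLpNorm' zero_lt_two] at h
  refine lt_of_eq_of_lt ?_ hprod
  exact (lintegral_prod _ (hgm.enorm.pow_const _)).symm

/-- **Almost every slice of an `L²((0,T) × E)` field is in `L²(E)`** (Tonelli): if `g` is jointly
a.e.-strongly measurable on `(0,T) × E` with `‖g‖_{L²((0,T) × E)} < ∞`, then `g(s) ∈ L²(E)` for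
a.e. `s ∈ (0,T)`. [cite: Sohr2001, Ch. V §1.4, proof of Thm. 1.4.1 (bookkeeping step)] -/
theorem ae_memLp_two_slice_of_eLpNorm_prod {g : ℝ → E → E}
    (hgm : AEStronglyMeasurable (uncurry g) ((volume.restrict (Ioo 0 T)).prod (volume : Measure E)))
    (hg2 : eLpNorm (uncurry g) 2 ((volume.restrict (Ioo 0 T)).prod (volume : Measure E)) < ⊤) :
    ∀ᵐ s ∂(volume.restrict (Ioo 0 T)), MemLp (g s) 2 volume := by
  -- slices are a.e.-strongly measurable for a.e. `s`
  have hsl : ∀ᵐ s ∂(volume.restrict (Ioo 0 T)), AEStronglyMeasurable (g s) volume := by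
    filter_upwards [hgm.prodMk_left] with s hs
    exact hs
  have hiter := lintegral_lintegral_sq_lt_top_of_eLpNorm_prod hgm hg2
  have hm : AEMeasurable (fun s => ∫⁻ x, ‖g s x‖ₑ ^ (2 : ℝ) ∂volume) (volume.restrict (Ioo 0 T)) :=
    (hgm.enorm.pow_const _).lintegral_prod_right'
  filter_upwards [hsl, ae_lt_top' hm hiter.ne] with s hs1 hs2
  refine ⟨hs1, ?_⟩
  rw [eLpNorm_eq_lintegral_rpow_enorm_toReal two_ne_zero ENNReal.ofNat_ne_top, ENNReal.toReal_ofNat]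
  exact ENNReal.rpow_lt_top_of_nonneg (by norm_num) hs2.ne

/-- `∫₀ᵀ ‖g(s)‖₂ ds < ∞` for an `L²((0,T) × E)` field (`‖g(s)‖₂ ≤ 1 + ‖g(s)‖₂²` and Tonelli; the
interval is bounded: `L²(0,T;L²) ⊂ L¹(0,T;L²)`, Sohr's class (1.5.1)). [cite: Sohr2001, Ch. V §1.4, proof of Thm. 1.4.1 (bookkeeping step)] -/
theorem lintegral_eLpNorm_two_slice_lt_top_of_eLpNorm_prod {g : ℝ → E → E}
    (hgm : AEStronglyMeasurable (uncurry g) ((volume.restrict (Ioo 0 T)).prod (volume : Measure E)))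
    (hg2 : eLpNorm (uncurry g) 2 ((volume.restrict (Ioo 0 T)).prod (volume : Measure E)) < ⊤) :
    ∫⁻ s in Ioo 0 T, eLpNorm (g s) 2 volume < ⊤ := by
  have hiter := lintegral_lintegral_sq_lt_top_of_eLpNorm_prod hgm hg2
  have hsq : ∀ s, eLpNorm (g s) 2 volume ^ (2 : ℝ) = ∫⁻ x, ‖g s x‖ₑ ^ (2 : ℝ) ∂volume := by
    intro s
    rw [eLpNorm_eq_lintegral_rpow_enorm_toReal two_ne_zero ENNReal.ofNat_ne_top, ENNReal.toReal_ofNat,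
      ← ENNReal.rpow_mul]
    norm_num
  calc ∫⁻ s in Ioo 0 T, eLpNorm (g s) 2 volume
      ≤ ∫⁻ s in Ioo 0 T, (1 + eLpNorm (g s) 2 volume ^ (2 : ℝ)) :=
        lintegral_mono fun s => ENNReal.le_one_add_rpow_two _
    _ = ∫⁻ _ in Ioo 0 T, (1 : ℝ≥0∞) ∂volume + ∫⁻ s in Ioo 0 T, ∫⁻ x, ‖g s x‖ₑ ^ (2 : ℝ) ∂volume := by
        rw [lintegral_add_left' aemeasurable_const]
        simp_rw [hsq]
    _ < ⊤ := by
        refine ENNReal.add_lt_top.2 ⟨?_, hiter⟩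
        rw [lintegral_const, Measure.restrict_apply_univ, Real.volume_Ioo, one_mul]
        exact ENNReal.ofReal_lt_top

/-- The force pairing `s ↦ ∫ ⟪g(s), Ψ⟫` with an `L²` field is a.e.-strongly measurable on `(0,T)`
(joint measurability and Fubini). [cite: Sohr2001, Ch. V §1.4, proof of Thm. 1.4.1 (bookkeeping step)] -/
theorem aestronglyMeasurable_forcePairing {g : ℝ → E → E}
    (hgm : AEStronglyMeasurable (uncurry g) ((volume.restrict (Ioo 0 T)).prod (volume : Measure E)))
    {Ψ : E → E} (hΨ : AEStronglyMeasurable Ψ (volume : Measure E)) :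
    AEStronglyMeasurable (fun s => ∫ x, ⟪g s x, Ψ x⟫) (volume.restrict (Ioo 0 T)) := by
  have h1 : AEStronglyMeasurable (fun p : ℝ × E => ⟪uncurry g p, Ψ p.2⟫)
      (((volume : Measure ℝ).restrict (Ioo 0 T)).prod (volume : Measure E)) :=
    hgm.inner hΨ.comp_snd
  exact h1.integral_prod_right'

/-- **The force pairing with an `L²` field is integrable in time**: for `g ∈ L²((0,T) × E)` jointly
a.e.-strongly measurable and `Ψ ∈ L²(E)`, `s ↦ ∫ ⟪g(s), Ψ⟫` is integrable on `(0,T)`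
(`|∫⟪g(s),Ψ⟫| ≤ E(g(s)) + E(Ψ)` and `s ↦ E(g(s)) = ½∫|g(s)|²` is integrable by Tonelli): the work
term `∫₀ᵗ⟨f, v⟩` of Sohr 2001, Ch. V (1.4.3)–(1.4.4) is a genuine integral.
[cite: Sohr2001, Ch. V §1.4, proof of Thm. 1.4.1 (bookkeeping step)] -/
theorem integrableOn_forcePairing_of_eLpNorm_prod {g : ℝ → E → E}
    (hgm : AEStronglyMeasurable (uncurry g) ((volume.restrict (Ioo 0 T)).prod (volume : Measure E)))
    (hg2 : eLpNorm (uncurry g) 2 ((volume.restrict (Ioo 0 T)).prod (volume : Measure E)) < ⊤)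
    {Ψ : E → E} (hΨ : MemLp Ψ 2 (volume : Measure E)) :
    IntegrableOn (fun s => ∫ x, ⟪g s x, Ψ x⟫) (Ioo 0 T) := by
  have hsl := ae_memLp_two_slice_of_eLpNorm_prod hgm hg2
  have hiter := lintegral_lintegral_sq_lt_top_of_eLpNorm_prod hgm hg2
  have hm : AEMeasurable (fun s => ∫⁻ x, ‖g s x‖ₑ ^ (2 : ℝ) ∂volume) (volume.restrict (Ioo 0 T)) :=
    (hgm.enorm.pow_const _).lintegral_prod_right'
  -- the dominating function `s ↦ ½ (∫⁻ ‖g s‖ₑ²).toReal + E(Ψ)`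
  have hDint : Integrable (fun s => (∫⁻ x, ‖g s x‖ₑ ^ (2 : ℝ) ∂volume).toReal)
      (volume.restrict (Ioo 0 T)) :=
    integrable_toReal_of_lintegral_ne_top hm hiter.ne
  haveI : IsFiniteMeasure (volume.restrict (Ioo (0 : ℝ) T)) := by infer_instance
  have hdom : Integrable (fun s => 2⁻¹ * (∫⁻ x, ‖g s x‖ₑ ^ (2 : ℝ) ∂volume).toReal +
      VectorCalculus.kineticEnergy Ψ) (volume.restrict (Ioo 0 T)) :=
    (hDint.const_mul _).add (integrable_const _)
  refine hdom.mono' (aestronglyMeasurable_forcePairing hgm hΨ.1) ?_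
  filter_upwards [hsl] with s hs
  rw [Real.norm_eq_abs]
  have hK : VectorCalculus.kineticEnergy (g s) = 2⁻¹ * (∫⁻ x, ‖g s x‖ₑ ^ (2 : ℝ) ∂volume).toReal := by
    have h1 : ∫⁻ x, ‖g s x‖ₑ ^ (2 : ℝ) ∂volume =
        ENNReal.ofReal (2 * VectorCalculus.kineticEnergy (g s)) := by
      rw [← eEnergy_eq_ofReal _ hs, eEnergy]
      exact lintegral_congr fun x => ENNReal.rpow_two _
    rw [h1, ENNReal.toReal_ofReal (mul_nonneg zero_le_two (kineticEnergy_nonneg _))]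
    ring
  calc |∫ x, ⟪g s x, Ψ x⟫| ≤ VectorCalculus.kineticEnergy (g s) + VectorCalculus.kineticEnergy Ψ :=
        abs_integral_inner_le_kineticEnergy_add hs hΨ
    _ = 2⁻¹ * (∫⁻ x, ‖g s x‖ₑ ^ (2 : ℝ) ∂volume).toReal + VectorCalculus.kineticEnergy Ψ := by
        rw [hK]

/-- **The time-sliced weak formulation of a Leray–Hopf solution of the FORCED system.** Let `u` be
a Leray–Hopf weak solution of the forced Navier–Stokes system on `E × [0, T)`, `T > 0`, with datum
`u₀` and force `f ∈ L²((0,T) × E)` (jointly a.e.-strongly measurable), and let `Ψ ∈ C_c^∞(E; E)`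
be divergence free. Then for **every** `t ∈ (0, T]`
`⟨u(t), Ψ⟩ = ⟨u₀, Ψ⟩ + ∫_{(0,t]} ( ∫ (⟪u, (u·∇)Ψ⟫ + ν ⟪u, ΔΨ⟫) dx + ∫ ⟪f, Ψ⟫ dx ) ds`
(Serrin 1963, §3, (6); Galdi 2000, Lemma 2.1; Sohr 2001, Ch. V (1.1.3)–(1.1.4): the forced weak
formulation sliced in time). Proof: `IsWeakNSSolutionOn.test_smul_forced` feeds the du
Bois-Reymond lemma with initial datum (`FunctionSpaces.eq_add_setIntegral_of_forall_test`) with the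
flux `F + P`, `P(s) = ∫⟪f(s),Ψ⟫` integrable by `integrableOn_forcePairing_of_eLpNorm_prod`; the
continuous representative is supplied by the weak `L²`-continuity clause of `IsLerayHopfOn` on
`(0, T]`; the endpoint `t = T` follows by letting `t → T⁻`. [cite: Serrin1963, §3 (6) with force; Galdi2000, Lemma 2.1] -/
theorem IsLerayHopfOn.inner_test_eq_forced (hu : IsLerayHopfOn T ν f u₀ u) (hT : 0 < T)
    (hfm : AEStronglyMeasurable (uncurry f) ((volume.restrict (Ioo 0 T)).prod (volume : Measure E)))
    (hf2 : eLpNorm (uncurry f) 2 ((volume.restrict (Ioo 0 T)).prod (volume : Measure E)) < ⊤)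
    {Ψ : E → E} (hΨ : FunctionSpaces.IsTestFunctionOn (⊤ : Opens E) Ψ)
    (hΨdiv : VectorCalculus.IsDivFree Ψ) {t : ℝ} (ht : t ∈ Ioc 0 T) :
    ∫ x, ⟪u t x, Ψ x⟫ = (∫ x, ⟪u₀ x, Ψ x⟫) +
      ∫ s in Ioc 0 t, ((∫ x, (⟪u s x, convect (u s) Ψ x⟫ + ν * ⟪u s x, (Δ Ψ) x⟫)) +
        ∫ x, ⟪f s x, Ψ x⟫) := by
  have hUint := hu.integrableOn_inner hΨ
  have hFint : IntegrableOn (fun s => (∫ x, (⟪u s x, convect (u s) Ψ x⟫ + ν * ⟪u s x, (Δ Ψ) x⟫)) +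
      ∫ x, ⟪f s x, Ψ x⟫) (Ioo 0 T) :=
    (hu.integrableOn_flux hΨ).add (integrableOn_forcePairing_of_eLpNorm_prod hfm hf2 (hΨ.memLp_volume 2))
  have hUcont : ContinuousOn (fun s => ∫ x, ⟪u s x, Ψ x⟫) (Ioc 0 T) :=
    (hu.weak_continuous Ψ (hΨ.memLp_volume 2)).1
  have hid : ∀ η : ℝ → ℝ, ContDiff ℝ ∞ η → HasCompactSupport η → tsupport η ⊆ Iio T →
      (∫ s in Ioo 0 T, (deriv η s * (∫ x, ⟪u s x, Ψ x⟫) +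
        η s * ((∫ x, (⟪u s x, convect (u s) Ψ x⟫ + ν * ⟪u s x, (Δ Ψ) x⟫)) +
          ∫ x, ⟪f s x, Ψ x⟫))) +
        η 0 * (∫ x, ⟪u₀ x, Ψ x⟫) = 0 := fun η hη hηc hηT =>
    hu.weak.test_smul_forced (fun s hs => hu.memLp s (Ioo_subset_Icc_self hs))
      (ae_memLp_two_slice_of_eLpNorm_prod hfm hf2) hΨ hΨdiv hη hηc hηT
  have hIoo : ∀ t ∈ Ioo 0 T, ∫ x, ⟪u t x, Ψ x⟫ = (∫ x, ⟪u₀ x, Ψ x⟫) +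
      ∫ s in Ioc 0 t, ((∫ x, (⟪u s x, convect (u s) Ψ x⟫ + ν * ⟪u s x, (Δ Ψ) x⟫)) +
        ∫ x, ⟪f s x, Ψ x⟫) := fun t ht =>
    FunctionSpaces.eq_add_setIntegral_of_forall_test hUint hFint (hUcont.mono Ioo_subset_Ioc_self)
      hid ht
  rcases lt_or_eq_of_le ht.2 with htT | rfl
  · exact hIoo t ⟨ht.1, htT⟩
  · -- the endpoint: both sides are limits from the left within `(0, T)`
    haveI : (𝓝[Ioo 0 t] t).NeBot := by
      refine mem_closure_iff_nhdsWithin_neBot.1 ?_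
      rw [closure_Ioo hT.ne]
      exact right_mem_Icc.2 hT.le
    have h1 : Tendsto (fun s => ∫ x, ⟪u s x, Ψ x⟫) (𝓝[Ioo 0 t] t) (𝓝 (∫ x, ⟪u t x, Ψ x⟫)) :=
      (hUcont t ⟨hT, le_rfl⟩).mono Ioo_subset_Ioc_self
    have hFint' : IntegrableOn
        (fun s => (∫ x, (⟪u s x, convect (u s) Ψ x⟫ + ν * ⟪u s x, (Δ Ψ) x⟫)) +
          ∫ x, ⟪f s x, Ψ x⟫) (Icc 0 t) :=
      (integrableOn_Icc_iff_integrableOn_Ioo (by simp) (by simp)).2 hFint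
    have h2 : Tendsto (fun τ => (∫ x, ⟪u₀ x, Ψ x⟫) +
        ∫ s in Ioc 0 τ, ((∫ x, (⟪u s x, convect (u s) Ψ x⟫ + ν * ⟪u s x, (Δ Ψ) x⟫)) +
          ∫ x, ⟪f s x, Ψ x⟫)) (𝓝[Ioo 0 t] t)
        (𝓝 ((∫ x, ⟪u₀ x, Ψ x⟫) +
          ∫ s in Ioc 0 t, ((∫ x, (⟪u s x, convect (u s) Ψ x⟫ + ν * ⟪u s x, (Δ Ψ) x⟫)) +
            ∫ x, ⟪f s x, Ψ x⟫))) := by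
      have hprim : ContinuousWithinAt (fun τ => ∫ s in Ioc 0 τ,
          ((∫ x, (⟪u s x, convect (u s) Ψ x⟫ + ν * ⟪u s x, (Δ Ψ) x⟫)) + ∫ x, ⟪f s x, Ψ x⟫))
          (Ioo 0 t) t :=
        (intervalIntegral.continuousOn_primitive hFint' t (right_mem_Icc.2 hT.le)).mono
          Ioo_subset_Icc_self
      exact tendsto_const_nhds.add hprim
    have heq : (fun s => ∫ x, ⟪u s x, Ψ x⟫) =ᶠ[𝓝[Ioo 0 t] t] fun τ => (∫ x, ⟪u₀ x, Ψ x⟫) +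
        ∫ s in Ioc 0 τ, ((∫ x, (⟪u s x, convect (u s) Ψ x⟫ + ν * ⟪u s x, (Δ Ψ) x⟫)) +
          ∫ x, ⟪f s x, Ψ x⟫) :=
      eventually_mem_nhdsWithin.mono fun τ hτ => hIoo τ hτ
    exact tendsto_nhds_unique (h1.congr' heq) h2

end Slice

end Literature.Analysis.FluidPDE
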